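import Mathlib
import Literature.NumberTheory.Transcendental.PreBlochPlaces
import Summits.KontsevichZagierPeriods.KontsevichZagierPeriods.Theorems.HyperbolicBlochZagierDilogarithmConjectureGaussCertificate
import HarnessLib

/-!
# `ZagierDilogarithmConjecture` (stmt-KontsevichZagierPeriods-10550) — line `kummer-clausen-linearisation`
# (c5 cycle 4, "Gaussian exceptional-unit sector"): five-term instances, part One

**The Gaussian exceptional-unit sector, instances.** `ℤ[i,1/10]` has 147 exceptional units (`z`, `1 − z` both
`{1+i, 2+i, 2−i}`-units; count stable in every exponent box ≥ (8,4)); modulo the anharmonic and conjugation relators they fall into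
15 classes with representatives `r₀,…,r₁₄` (2 further classes are real). Exact linear algebra (lead c5, `scratch/gauss/sector*.py`):
the five-term instances with exceptional arguments span a space `V` of dimension 12 on these 15 classes, the Dehn-zero subspace `W`
has dimension 13, and `W = V ⊕ ℚ[i]`. TWELVE instances span `V`; they are proved here as identities in the pre-Bloch group `𝒫(F)` of any
algebraically closed field `F` of characteristic `0` with `Z² = −1` (Neumann's five-term relation `PreBloch.sym_five_term`, arguments
reduced mod `Z² + 1` by `linear_combination`, moved to orbit representatives by the `PreBlochPlaces` lemmas). Generated by
`scratch/gauss/sectorgen.py`. Sorry-free; axioms ⊆ {propext, Classical.choice, Quot.sound}.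
Instances coinciding with those of certificate #3 (`gauss_F*`, file `…GaussCertificate`) are reused, not restated.
-/

noncomputable section

open Literature.NumberTheory.Transcendental

namespace Summit.KontsevichZagierPeriods.HyperbolicBloch.ZagierDilogarithmCertificate


/-- Five-term instance `gsec_F1` of the Gaussian exceptional-unit sector at `(a, b) = (((-1 / 2 : F) * Z), ((1 / 2 : F)))` (coordinates in
`ℚ[Z]/(Z²+1)`, `Z = i`), reduced to anharmonic orbit representatives. [cite: Neumann1998, eq. (2.3)] -/
theorem gsec_F1 {F : Type*} [Field F] [IsAlgClosed F] [CharZero F] (Z : F)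
    (hΦ : Z ^ 2 + 1 = 0) :
    (1 : ℤ) • PreBloch.sym ((-1 / 2 : F) * Z) + (-1 : ℤ) • PreBloch.sym ((-1 : F)) + (-1 : ℤ) • PreBloch.sym ((-1 : F) * Z) + (-1 : ℤ) • PreBloch.sym ((-1 : F) + (2 : F) * Z) + (-1 : ℤ) • PreBloch.sym ((-1 : F) + (-1 : F) * Z) = 0 := by
  have ha0 : ((-1 / 2 : F) * Z) ≠ 0 :=
    left_ne_zero_of_mul_eq_one (b := ((2 : F) * Z)) (by linear_combination ((-1 : F)) * hΦ)
  have ha1 : ((-1 / 2 : F) * Z) ≠ ((1 : F)) := by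
    refine sub_ne_zero.1 (left_ne_zero_of_mul_eq_one (b := ((-4 / 5 : F) + (2 / 5 : F) * Z)) ?_)
    linear_combination ((-1 / 5 : F)) * hΦ
  have hb0 : ((1 / 2 : F)) ≠ 0 :=
    left_ne_zero_of_mul_eq_one (b := ((2 : F))) (by linear_combination (0 : F) * hΦ)
  have hb1 : ((1 / 2 : F)) ≠ ((1 : F)) := by
    refine sub_ne_zero.1 (left_ne_zero_of_mul_eq_one (b := ((-2 : F))) ?_)
    linear_combination (0 : F) * hΦ
  have hab : ((-1 / 2 : F) * Z) ≠ ((1 / 2 : F)) := by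
    refine sub_ne_zero.1 (left_ne_zero_of_mul_eq_one (b := ((-1 : F) + (1 : F) * Z)) ?_)
    linear_combination ((-1 / 2 : F)) * hΦ
  have h := PreBloch.sym_five_term ⟨ha0, ha1⟩ ⟨hb0, hb1⟩ hab
  have hai : (((-1 / 2 : F) * Z))⁻¹ = ((2 : F) * Z) := inv_eq_of_mul_eq_one_right (by linear_combination ((-1 : F)) * hΦ)
  have hbi : (((1 / 2 : F)))⁻¹ = ((2 : F)) := inv_eq_of_mul_eq_one_right (by linear_combination (0 : F) * hΦ)
  have e3 : ((1 / 2 : F)) / ((-1 / 2 : F) * Z) = ((1 : F) * Z) := by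
    rw [div_eq_iff ha0]
    linear_combination ((1 / 2 : F)) * hΦ
  have h1b : (1 : F) - (((1 / 2 : F)))⁻¹ ≠ 0 := by
    rw [hbi]; exact left_ne_zero_of_mul_eq_one (b := ((-1 : F))) (by linear_combination (0 : F) * hΦ)
  have e4 : (1 - (((-1 / 2 : F) * Z))⁻¹) / (1 - (((1 / 2 : F)))⁻¹) = ((-1 : F) + (2 : F) * Z) := by
    rw [div_eq_iff h1b, hai, hbi]
    linear_combination (0 : F) * hΦ
  have e5 : (1 - ((-1 / 2 : F) * Z)) / (1 - ((1 / 2 : F))) = ((2 : F) + (1 : F) * Z) := by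
    rw [div_eq_iff (sub_ne_zero.2 hb1.symm)]
    linear_combination (0 : F) * hΦ
  rw [e3, e4, e5] at h
  have S1 : PreBloch.sym ((1 / 2 : F)) = PreBloch.sym ((-1 : F)) := by
    have hm : (1 - ((-1 : F))) * ((1 / 2 : F)) = 1 := by linear_combination (0 : F) * hΦ
    calc PreBloch.sym ((1 / 2 : F)) = PreBloch.sym (1 - ((-1 : F)))⁻¹ := congrArg PreBloch.sym (inv_eq_of_mul_eq_one_right hm).symm
      _ = PreBloch.sym ((-1 : F)) := PreBloch.sym_inv_one_sub _
  have S2 : PreBloch.sym ((1 : F) * Z) = -PreBloch.sym ((-1 : F) * Z) := by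
    have hm : ((-1 : F) * Z) * ((1 : F) * Z) = 1 := by linear_combination ((-1 : F)) * hΦ
    calc PreBloch.sym ((1 : F) * Z) = PreBloch.sym (((-1 : F) * Z))⁻¹ := congrArg PreBloch.sym (inv_eq_of_mul_eq_one_right hm).symm
      _ = -PreBloch.sym ((-1 : F) * Z) := PreBloch.sym_inv _
  have S3 : PreBloch.sym ((2 : F) + (1 : F) * Z) = -PreBloch.sym ((-1 : F) + (-1 : F) * Z) := by
    have hp : ((2 : F) + (1 : F) * Z) = 1 - ((-1 : F) + (-1 : F) * Z) := by linear_combination (0 : F) * hΦ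
    calc PreBloch.sym ((2 : F) + (1 : F) * Z) = PreBloch.sym (1 - ((-1 : F) + (-1 : F) * Z)) := congrArg PreBloch.sym hp
      _ = -PreBloch.sym ((-1 : F) + (-1 : F) * Z) := PreBloch.sym_one_sub _
  rw [S1, S2, S3] at h
  calc (1 : ℤ) • PreBloch.sym ((-1 / 2 : F) * Z) + (-1 : ℤ) • PreBloch.sym ((-1 : F)) + (-1 : ℤ) • PreBloch.sym ((-1 : F) * Z) + (-1 : ℤ) • PreBloch.sym ((-1 : F) + (2 : F) * Z) + (-1 : ℤ) • PreBloch.sym ((-1 : F) + (-1 : F) * Z)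
      = PreBloch.sym ((-1 / 2 : F) * Z) - PreBloch.sym ((-1 : F)) + (-PreBloch.sym ((-1 : F) * Z)) - PreBloch.sym ((-1 : F) + (2 : F) * Z) + (-PreBloch.sym ((-1 : F) + (-1 : F) * Z)) := by abel
    _ = 0 := h

/-- Five-term instance `gsec_F2` of the Gaussian exceptional-unit sector at `(a, b) = (((-1 / 10 : F) + (-1 / 5 : F) * Z), ((1 / 2 : F)))` (coordinates in
`ℚ[Z]/(Z²+1)`, `Z = i`), reduced to anharmonic orbit representatives. [cite: Neumann1998, eq. (2.3)] -/
theorem gsec_F2 {F : Type*} [Field F] [IsAlgClosed F] [CharZero F] (Z : F)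
    (hΦ : Z ^ 2 + 1 = 0) :
    (-1 : ℤ) • PreBloch.sym ((-2 : F) + (4 : F) * Z) + (-1 : ℤ) • PreBloch.sym ((-1 : F)) + (1 : ℤ) • PreBloch.sym ((-1 : F) + (2 : F) * Z) + (-1 : ℤ) • PreBloch.sym ((-3 : F) + (4 : F) * Z) + (-1 : ℤ) • PreBloch.sym ((-6 / 5 : F) + (-2 / 5 : F) * Z) = 0 := by
  have ha0 : ((-1 / 10 : F) + (-1 / 5 : F) * Z) ≠ 0 :=
    left_ne_zero_of_mul_eq_one (b := ((-2 : F) + (4 : F) * Z)) (by linear_combination ((-4 / 5 : F)) * hΦ)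
  have ha1 : ((-1 / 10 : F) + (-1 / 5 : F) * Z) ≠ ((1 : F)) := by
    refine sub_ne_zero.1 (left_ne_zero_of_mul_eq_one (b := ((-22 / 25 : F) + (4 / 25 : F) * Z)) ?_)
    linear_combination ((-4 / 125 : F)) * hΦ
  have hb0 : ((1 / 2 : F)) ≠ 0 :=
    left_ne_zero_of_mul_eq_one (b := ((2 : F))) (by linear_combination (0 : F) * hΦ)
  have hb1 : ((1 / 2 : F)) ≠ ((1 : F)) := by
    refine sub_ne_zero.1 (left_ne_zero_of_mul_eq_one (b := ((-2 : F))) ?_)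
    linear_combination (0 : F) * hΦ
  have hab : ((-1 / 10 : F) + (-1 / 5 : F) * Z) ≠ ((1 / 2 : F)) := by
    refine sub_ne_zero.1 (left_ne_zero_of_mul_eq_one (b := ((-3 / 2 : F) + (1 / 2 : F) * Z)) ?_)
    linear_combination ((-1 / 10 : F)) * hΦ
  have h := PreBloch.sym_five_term ⟨ha0, ha1⟩ ⟨hb0, hb1⟩ hab
  have hai : (((-1 / 10 : F) + (-1 / 5 : F) * Z))⁻¹ = ((-2 : F) + (4 : F) * Z) := inv_eq_of_mul_eq_one_right (by linear_combination ((-4 / 5 : F)) * hΦ)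
  have hbi : (((1 / 2 : F)))⁻¹ = ((2 : F)) := inv_eq_of_mul_eq_one_right (by linear_combination (0 : F) * hΦ)
  have e3 : ((1 / 2 : F)) / ((-1 / 10 : F) + (-1 / 5 : F) * Z) = ((-1 : F) + (2 : F) * Z) := by
    rw [div_eq_iff ha0]
    linear_combination ((2 / 5 : F)) * hΦ
  have h1b : (1 : F) - (((1 / 2 : F)))⁻¹ ≠ 0 := by
    rw [hbi]; exact left_ne_zero_of_mul_eq_one (b := ((-1 : F))) (by linear_combination (0 : F) * hΦ)
  have e4 : (1 - (((-1 / 10 : F) + (-1 / 5 : F) * Z))⁻¹) / (1 - (((1 / 2 : F)))⁻¹) = ((-3 : F) + (4 : F) * Z) := by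
    rw [div_eq_iff h1b, hai, hbi]
    linear_combination (0 : F) * hΦ
  have e5 : (1 - ((-1 / 10 : F) + (-1 / 5 : F) * Z)) / (1 - ((1 / 2 : F))) = ((11 / 5 : F) + (2 / 5 : F) * Z) := by
    rw [div_eq_iff (sub_ne_zero.2 hb1.symm)]
    linear_combination (0 : F) * hΦ
  rw [e3, e4, e5] at h
  have S1 : PreBloch.sym ((-1 / 10 : F) + (-1 / 5 : F) * Z) = -PreBloch.sym ((-2 : F) + (4 : F) * Z) := by
    have hm : ((-2 : F) + (4 : F) * Z) * ((-1 / 10 : F) + (-1 / 5 : F) * Z) = 1 := by linear_combination ((-4 / 5 : F)) * hΦ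
    calc PreBloch.sym ((-1 / 10 : F) + (-1 / 5 : F) * Z) = PreBloch.sym (((-2 : F) + (4 : F) * Z))⁻¹ := congrArg PreBloch.sym (inv_eq_of_mul_eq_one_right hm).symm
      _ = -PreBloch.sym ((-2 : F) + (4 : F) * Z) := PreBloch.sym_inv _
  have S2 : PreBloch.sym ((1 / 2 : F)) = PreBloch.sym ((-1 : F)) := by
    have hm : (1 - ((-1 : F))) * ((1 / 2 : F)) = 1 := by linear_combination (0 : F) * hΦ
    calc PreBloch.sym ((1 / 2 : F)) = PreBloch.sym (1 - ((-1 : F)))⁻¹ := congrArg PreBloch.sym (inv_eq_of_mul_eq_one_right hm).symm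
      _ = PreBloch.sym ((-1 : F)) := PreBloch.sym_inv_one_sub _
  have S3 : PreBloch.sym ((11 / 5 : F) + (2 / 5 : F) * Z) = -PreBloch.sym ((-6 / 5 : F) + (-2 / 5 : F) * Z) := by
    have hp : ((11 / 5 : F) + (2 / 5 : F) * Z) = 1 - ((-6 / 5 : F) + (-2 / 5 : F) * Z) := by linear_combination (0 : F) * hΦ
    calc PreBloch.sym ((11 / 5 : F) + (2 / 5 : F) * Z) = PreBloch.sym (1 - ((-6 / 5 : F) + (-2 / 5 : F) * Z)) := congrArg PreBloch.sym hp
      _ = -PreBloch.sym ((-6 / 5 : F) + (-2 / 5 : F) * Z) := PreBloch.sym_one_sub _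
  rw [S1, S2, S3] at h
  calc (-1 : ℤ) • PreBloch.sym ((-2 : F) + (4 : F) * Z) + (-1 : ℤ) • PreBloch.sym ((-1 : F)) + (1 : ℤ) • PreBloch.sym ((-1 : F) + (2 : F) * Z) + (-1 : ℤ) • PreBloch.sym ((-3 : F) + (4 : F) * Z) + (-1 : ℤ) • PreBloch.sym ((-6 / 5 : F) + (-2 / 5 : F) * Z)
      = (-PreBloch.sym ((-2 : F) + (4 : F) * Z)) - PreBloch.sym ((-1 : F)) + PreBloch.sym ((-1 : F) + (2 : F) * Z) - PreBloch.sym ((-3 : F) + (4 : F) * Z) + (-PreBloch.sym ((-6 / 5 : F) + (-2 / 5 : F) * Z)) := by abel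
    _ = 0 := h

/-- Five-term instance `gsec_F3` of the Gaussian exceptional-unit sector at `(a, b) = (((-1 / 2 : F) * Z), ((1 : F) + (1 / 2 : F) * Z))` (coordinates in
`ℚ[Z]/(Z²+1)`, `Z = i`), reduced to anharmonic orbit representatives. [cite: Neumann1998, eq. (2.3)] -/
theorem gsec_F3 {F : Type*} [Field F] [IsAlgClosed F] [CharZero F] (Z : F)
    (hΦ : Z ^ 2 + 1 = 0) :
    (2 : ℤ) • PreBloch.sym ((-1 / 2 : F) * Z) + (2 : ℤ) • PreBloch.sym ((-1 : F) + (2 : F) * Z) + (-1 : ℤ) • PreBloch.sym ((-3 : F) + (-4 : F) * Z) = 0 := by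
  have ha0 : ((-1 / 2 : F) * Z) ≠ 0 :=
    left_ne_zero_of_mul_eq_one (b := ((2 : F) * Z)) (by linear_combination ((-1 : F)) * hΦ)
  have ha1 : ((-1 / 2 : F) * Z) ≠ ((1 : F)) := by
    refine sub_ne_zero.1 (left_ne_zero_of_mul_eq_one (b := ((-4 / 5 : F) + (2 / 5 : F) * Z)) ?_)
    linear_combination ((-1 / 5 : F)) * hΦ
  have hb0 : ((1 : F) + (1 / 2 : F) * Z) ≠ 0 :=
    left_ne_zero_of_mul_eq_one (b := ((4 / 5 : F) + (-2 / 5 : F) * Z)) (by linear_combination ((-1 / 5 : F)) * hΦ)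
  have hb1 : ((1 : F) + (1 / 2 : F) * Z) ≠ ((1 : F)) := by
    refine sub_ne_zero.1 (left_ne_zero_of_mul_eq_one (b := ((-2 : F) * Z)) ?_)
    linear_combination ((-1 : F)) * hΦ
  have hab : ((-1 / 2 : F) * Z) ≠ ((1 : F) + (1 / 2 : F) * Z) := by
    refine sub_ne_zero.1 (left_ne_zero_of_mul_eq_one (b := ((-1 / 2 : F) + (1 / 2 : F) * Z)) ?_)
    linear_combination ((-1 / 2 : F)) * hΦ
  have h := PreBloch.sym_five_term ⟨ha0, ha1⟩ ⟨hb0, hb1⟩ hab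
  have hai : (((-1 / 2 : F) * Z))⁻¹ = ((2 : F) * Z) := inv_eq_of_mul_eq_one_right (by linear_combination ((-1 : F)) * hΦ)
  have hbi : (((1 : F) + (1 / 2 : F) * Z))⁻¹ = ((4 / 5 : F) + (-2 / 5 : F) * Z) := inv_eq_of_mul_eq_one_right (by linear_combination ((-1 / 5 : F)) * hΦ)
  have e3 : ((1 : F) + (1 / 2 : F) * Z) / ((-1 / 2 : F) * Z) = ((-1 : F) + (2 : F) * Z) := by
    rw [div_eq_iff ha0]
    linear_combination ((1 : F)) * hΦ
  have h1b : (1 : F) - (((1 : F) + (1 / 2 : F) * Z))⁻¹ ≠ 0 := by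
    rw [hbi]; exact left_ne_zero_of_mul_eq_one (b := ((1 : F) + (-2 : F) * Z)) (by linear_combination ((-4 / 5 : F)) * hΦ)
  have e4 : (1 - (((-1 / 2 : F) * Z))⁻¹) / (1 - (((1 : F) + (1 / 2 : F) * Z))⁻¹) = ((-3 : F) + (-4 : F) * Z) := by
    rw [div_eq_iff h1b, hai, hbi]
    linear_combination ((8 / 5 : F)) * hΦ
  have e5 : (1 - ((-1 / 2 : F) * Z)) / (1 - ((1 : F) + (1 / 2 : F) * Z)) = ((-1 : F) + (2 : F) * Z) := by
    rw [div_eq_iff (sub_ne_zero.2 hb1.symm)]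
    linear_combination ((1 : F)) * hΦ
  rw [e3, e4, e5] at h
  have S1 : PreBloch.sym ((1 : F) + (1 / 2 : F) * Z) = -PreBloch.sym ((-1 / 2 : F) * Z) := by
    have hp : ((1 : F) + (1 / 2 : F) * Z) = 1 - ((-1 / 2 : F) * Z) := by linear_combination (0 : F) * hΦ
    calc PreBloch.sym ((1 : F) + (1 / 2 : F) * Z) = PreBloch.sym (1 - ((-1 / 2 : F) * Z)) := congrArg PreBloch.sym hp
      _ = -PreBloch.sym ((-1 / 2 : F) * Z) := PreBloch.sym_one_sub _
  rw [S1] at h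
  calc (2 : ℤ) • PreBloch.sym ((-1 / 2 : F) * Z) + (2 : ℤ) • PreBloch.sym ((-1 : F) + (2 : F) * Z) + (-1 : ℤ) • PreBloch.sym ((-3 : F) + (-4 : F) * Z)
      = PreBloch.sym ((-1 / 2 : F) * Z) - (-PreBloch.sym ((-1 / 2 : F) * Z)) + PreBloch.sym ((-1 : F) + (2 : F) * Z) - PreBloch.sym ((-3 : F) + (-4 : F) * Z) + PreBloch.sym ((-1 : F) + (2 : F) * Z) := by abel
    _ = 0 := h

/-- Five-term instance `gsec_F6` of the Gaussian exceptional-unit sector at `(a, b) = (((-3 / 4 : F) + (-1 / 4 : F) * Z), ((-1 / 2 : F) * Z))` (coordinates in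
`ℚ[Z]/(Z²+1)`, `Z = i`), reduced to anharmonic orbit representatives. [cite: Neumann1998, eq. (2.3)] -/
theorem gsec_F6 {F : Type*} [Field F] [IsAlgClosed F] [CharZero F] (Z : F)
    (hΦ : Z ^ 2 + 1 = 0) :
    (-1 : ℤ) • PreBloch.sym ((-6 / 5 : F) + (2 / 5 : F) * Z) + (-1 : ℤ) • PreBloch.sym ((-1 / 2 : F) * Z) + (-1 : ℤ) • PreBloch.sym ((1 / 2 : F) + (-3 / 2 : F) * Z) + (1 : ℤ) • PreBloch.sym ((1 / 2 : F) + (-1 : F) * Z) + (1 : ℤ) • PreBloch.sym ((-1 : F) + (-1 : F) * Z) = 0 := by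
  have ha0 : ((-3 / 4 : F) + (-1 / 4 : F) * Z) ≠ 0 :=
    left_ne_zero_of_mul_eq_one (b := ((-6 / 5 : F) + (2 / 5 : F) * Z)) (by linear_combination ((-1 / 10 : F)) * hΦ)
  have ha1 : ((-3 / 4 : F) + (-1 / 4 : F) * Z) ≠ ((1 : F)) := by
    refine sub_ne_zero.1 (left_ne_zero_of_mul_eq_one (b := ((-14 / 25 : F) + (2 / 25 : F) * Z)) ?_)
    linear_combination ((-1 / 50 : F)) * hΦ
  have hb0 : ((-1 / 2 : F) * Z) ≠ 0 :=
    left_ne_zero_of_mul_eq_one (b := ((2 : F) * Z)) (by linear_combination ((-1 : F)) * hΦ)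
  have hb1 : ((-1 / 2 : F) * Z) ≠ ((1 : F)) := by
    refine sub_ne_zero.1 (left_ne_zero_of_mul_eq_one (b := ((-4 / 5 : F) + (2 / 5 : F) * Z)) ?_)
    linear_combination ((-1 / 5 : F)) * hΦ
  have hab : ((-3 / 4 : F) + (-1 / 4 : F) * Z) ≠ ((-1 / 2 : F) * Z) := by
    refine sub_ne_zero.1 (left_ne_zero_of_mul_eq_one (b := ((-6 / 5 : F) + (-2 / 5 : F) * Z)) ?_)
    linear_combination ((-1 / 10 : F)) * hΦ
  have h := PreBloch.sym_five_term ⟨ha0, ha1⟩ ⟨hb0, hb1⟩ hab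
  have hai : (((-3 / 4 : F) + (-1 / 4 : F) * Z))⁻¹ = ((-6 / 5 : F) + (2 / 5 : F) * Z) := inv_eq_of_mul_eq_one_right (by linear_combination ((-1 / 10 : F)) * hΦ)
  have hbi : (((-1 / 2 : F) * Z))⁻¹ = ((2 : F) * Z) := inv_eq_of_mul_eq_one_right (by linear_combination ((-1 : F)) * hΦ)
  have e3 : ((-1 / 2 : F) * Z) / ((-3 / 4 : F) + (-1 / 4 : F) * Z) = ((1 / 5 : F) + (3 / 5 : F) * Z) := by
    rw [div_eq_iff ha0]
    linear_combination ((3 / 20 : F)) * hΦ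
  have h1b : (1 : F) - (((-1 / 2 : F) * Z))⁻¹ ≠ 0 := by
    rw [hbi]; exact left_ne_zero_of_mul_eq_one (b := ((1 / 5 : F) + (2 / 5 : F) * Z)) (by linear_combination ((-4 / 5 : F)) * hΦ)
  have e4 : (1 - (((-3 / 4 : F) + (-1 / 4 : F) * Z))⁻¹) / (1 - (((-1 / 2 : F) * Z))⁻¹) = ((3 / 5 : F) + (4 / 5 : F) * Z) := by
    rw [div_eq_iff h1b, hai, hbi]
    linear_combination ((8 / 5 : F)) * hΦ
  have e5 : (1 - ((-3 / 4 : F) + (-1 / 4 : F) * Z)) / (1 - ((-1 / 2 : F) * Z)) = ((3 / 2 : F) + (-1 / 2 : F) * Z) := by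
    rw [div_eq_iff (sub_ne_zero.2 hb1.symm)]
    linear_combination ((1 / 4 : F)) * hΦ
  rw [e3, e4, e5] at h
  have S1 : PreBloch.sym ((-3 / 4 : F) + (-1 / 4 : F) * Z) = -PreBloch.sym ((-6 / 5 : F) + (2 / 5 : F) * Z) := by
    have hm : ((-6 / 5 : F) + (2 / 5 : F) * Z) * ((-3 / 4 : F) + (-1 / 4 : F) * Z) = 1 := by linear_combination ((-1 / 10 : F)) * hΦ
    calc PreBloch.sym ((-3 / 4 : F) + (-1 / 4 : F) * Z) = PreBloch.sym (((-6 / 5 : F) + (2 / 5 : F) * Z))⁻¹ := congrArg PreBloch.sym (inv_eq_of_mul_eq_one_right hm).symm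
      _ = -PreBloch.sym ((-6 / 5 : F) + (2 / 5 : F) * Z) := PreBloch.sym_inv _
  have S2 : PreBloch.sym ((1 / 5 : F) + (3 / 5 : F) * Z) = -PreBloch.sym ((1 / 2 : F) + (-3 / 2 : F) * Z) := by
    have hm : ((1 / 2 : F) + (-3 / 2 : F) * Z) * ((1 / 5 : F) + (3 / 5 : F) * Z) = 1 := by linear_combination ((-9 / 10 : F)) * hΦ
    calc PreBloch.sym ((1 / 5 : F) + (3 / 5 : F) * Z) = PreBloch.sym (((1 / 2 : F) + (-3 / 2 : F) * Z))⁻¹ := congrArg PreBloch.sym (inv_eq_of_mul_eq_one_right hm).symm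
      _ = -PreBloch.sym ((1 / 2 : F) + (-3 / 2 : F) * Z) := PreBloch.sym_inv _
  have S3 : PreBloch.sym ((3 / 5 : F) + (4 / 5 : F) * Z) = -PreBloch.sym ((1 / 2 : F) + (-1 : F) * Z) := by
    have hr : ((1 / 2 : F) + (-1 : F) * Z) - 1 ≠ 0 := left_ne_zero_of_mul_eq_one (b := ((-2 / 5 : F) + (4 / 5 : F) * Z)) (by linear_combination ((-4 / 5 : F)) * hΦ)
    have hp : ((3 / 5 : F) + (4 / 5 : F) * Z) = ((1 / 2 : F) + (-1 : F) * Z) / (((1 / 2 : F) + (-1 : F) * Z) - 1) := by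
      rw [eq_div_iff hr]
      linear_combination ((-4 / 5 : F)) * hΦ
    calc PreBloch.sym ((3 / 5 : F) + (4 / 5 : F) * Z) = PreBloch.sym (((1 / 2 : F) + (-1 : F) * Z) / (((1 / 2 : F) + (-1 : F) * Z) - 1)) := congrArg PreBloch.sym hp
      _ = -PreBloch.sym ((1 / 2 : F) + (-1 : F) * Z) := PreBloch.sym_div_sub_one _
  have S4 : PreBloch.sym ((3 / 2 : F) + (-1 / 2 : F) * Z) = PreBloch.sym ((-1 : F) + (-1 : F) * Z) := by
    have hm : ((-1 : F) + (-1 : F) * Z) * (1 - ((3 / 2 : F) + (-1 / 2 : F) * Z)) = 1 := by linear_combination ((-1 / 2 : F)) * hΦ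
    have hp : ((3 / 2 : F) + (-1 / 2 : F) * Z) = 1 - (((-1 : F) + (-1 : F) * Z))⁻¹ := by rw [inv_eq_of_mul_eq_one_right hm]; ring
    calc PreBloch.sym ((3 / 2 : F) + (-1 / 2 : F) * Z) = PreBloch.sym (1 - (((-1 : F) + (-1 : F) * Z))⁻¹) := congrArg PreBloch.sym hp
      _ = PreBloch.sym ((-1 : F) + (-1 : F) * Z) := PreBloch.sym_one_sub_inv _
  rw [S1, S2, S3, S4] at h
  calc (-1 : ℤ) • PreBloch.sym ((-6 / 5 : F) + (2 / 5 : F) * Z) + (-1 : ℤ) • PreBloch.sym ((-1 / 2 : F) * Z) + (-1 : ℤ) • PreBloch.sym ((1 / 2 : F) + (-3 / 2 : F) * Z) + (1 : ℤ) • PreBloch.sym ((1 / 2 : F) + (-1 : F) * Z) + (1 : ℤ) • PreBloch.sym ((-1 : F) + (-1 : F) * Z)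
      = (-PreBloch.sym ((-6 / 5 : F) + (2 / 5 : F) * Z)) - PreBloch.sym ((-1 / 2 : F) * Z) + (-PreBloch.sym ((1 / 2 : F) + (-3 / 2 : F) * Z)) - (-PreBloch.sym ((1 / 2 : F) + (-1 : F) * Z)) + PreBloch.sym ((-1 : F) + (-1 : F) * Z) := by abel
    _ = 0 := h

/-- **Registered stub `gsec_instances_one`**: the 6 five-term instances of this file (conjunction). [cite: Neumann1998, eq. (2.3)] -/
theorem gsec_instances_one :
    (∀ {F : Type*} [Field F] [IsAlgClosed F] [CharZero F] (Z : F) (hΦ : Z ^ 2 + 1 = 0), (1 : ℤ) • PreBloch.sym ((-1 / 2 : F) * Z) + (-1 : ℤ) • PreBloch.sym ((-1 : F)) + (-1 : ℤ) • PreBloch.sym ((-1 : F) * Z) + (-1 : ℤ) • PreBloch.sym ((-1 : F) + (2 : F) * Z) + (-1 : ℤ) • PreBloch.sym ((-1 : F) + (-1 : F) * Z) = 0) ∧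
    (∀ {F : Type*} [Field F] [IsAlgClosed F] [CharZero F] (Z : F) (hΦ : Z ^ 2 + 1 = 0), (-1 : ℤ) • PreBloch.sym ((-2 : F) + (4 : F) * Z) + (-1 : ℤ) • PreBloch.sym ((-1 : F)) + (1 : ℤ) • PreBloch.sym ((-1 : F) + (2 : F) * Z) + (-1 : ℤ) • PreBloch.sym ((-3 : F) + (4 : F) * Z) + (-1 : ℤ) • PreBloch.sym ((-6 / 5 : F) + (-2 / 5 : F) * Z) = 0) ∧
    (∀ {F : Type*} [Field F] [IsAlgClosed F] [CharZero F] (Z : F) (hΦ : Z ^ 2 + 1 = 0), (2 : ℤ) • PreBloch.sym ((-1 / 2 : F) * Z) + (2 : ℤ) • PreBloch.sym ((-1 : F) + (2 : F) * Z) + (-1 : ℤ) • PreBloch.sym ((-3 : F) + (-4 : F) * Z) = 0) ∧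
    (∀ {F : Type*} [Field F] [IsAlgClosed F] [CharZero F] (Z : F) (hΦ : Z ^ 2 + 1 = 0), (1 : ℤ) • PreBloch.sym ((-1 / 2 : F) * Z) + (-2 : ℤ) • PreBloch.sym ((-1 : F) * Z) + (2 : ℤ) • PreBloch.sym ((-1 : F) + (-1 : F) * Z) = 0) ∧
    (∀ {F : Type*} [Field F] [IsAlgClosed F] [CharZero F] (Z : F) (hΦ : Z ^ 2 + 1 = 0), (1 : ℤ) • PreBloch.sym ((1 / 2 : F) + (-1 : F) * Z) + (-1 : ℤ) • PreBloch.sym ((-1 : F) * Z) + (-1 : ℤ) • PreBloch.sym ((-1 : F) + (-1 : F) * Z) + (1 : ℤ) • PreBloch.sym ((1 / 2 : F) + (-3 / 2 : F) * Z) + (1 : ℤ) • PreBloch.sym ((-1 : F) + (1 : F) * Z) = 0) ∧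
    (∀ {F : Type*} [Field F] [IsAlgClosed F] [CharZero F] (Z : F) (hΦ : Z ^ 2 + 1 = 0), (-1 : ℤ) • PreBloch.sym ((-6 / 5 : F) + (2 / 5 : F) * Z) + (-1 : ℤ) • PreBloch.sym ((-1 / 2 : F) * Z) + (-1 : ℤ) • PreBloch.sym ((1 / 2 : F) + (-3 / 2 : F) * Z) + (1 : ℤ) • PreBloch.sym ((1 / 2 : F) + (-1 : F) * Z) + (1 : ℤ) • PreBloch.sym ((-1 : F) + (-1 : F) * Z) = 0) :=
  ⟨gsec_F1, gsec_F2, gsec_F3, gauss_F2, gauss_F3, gsec_F6⟩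

end Summit.KontsevichZagierPeriods.HyperbolicBloch.ZagierDilogarithmCertificate

end
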